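import Summits.Ventures.PercRepro.C041RcPortCountGen
import Summits.Ventures.PercRepro.C041RcPortCS
import Summits.Ventures.PercRepro.C041ZonePortCSAndLemma

/-!
# THEOREM R-CS ON EVERY SKELETON, «12 ∈ E OR NOT» (p6, gen 28; mine-3's C-041.md §17 (a) with REMARK (3) settled)

Setting of `C041RcPortCountGen` (the sources of `𝒮_rc(O)` split by the bridge flag `RedBridge`: with a bridge the
valid patterns are those with `X₁ ∨ X₂`, without it those with `X₁ ∧ X₂`; on each part the fibres of the admissible
patterns valid for the flag have one size and the others are empty — `card_rcFibreY_eq`, `rcFibreY_eq_empty`) and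
`C041RcPortCS` / `C041ZonePortCSAndLemma`.  On the part with flag `y` the three counts are `N_y` times the counts
of the port problem for the validity of `y` (`exists_counts_eq_mul_flag`), so (CS) holds on each part by THEOREM
R-CS in its `V_∨` form (`csOr_of_zonesReached`) and its `V_∧` form (`csAnd_of_zonesReached`); the two parts add by
the two-term CAUCHY–SCHWARZ step `cs_add`:

* **`rc_cs_of_bare_gen`** — per colouring, on every skeleton with the probe not adjacent to a terminal,
  `c ≠ a, b`, `a ≠ b`, NO edge between the terminals assumed;
* **`rc_cs_gen`** — summed over the colourings, `c ≠ a, b`, `a ≠ b`;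
* **`rc_theoremR_cs`** — on EVERY skeleton, no hypothesis: (CS) on the sources all of whose attached zones are
  internally red-connected (a coinciding mark leaves no source at all), the (CS) form of `rc_theoremR`.
-/

namespace PercRepro

namespace MultiGraph

open Finset ZonePort CSCount

variable {V E : Type*} {G : MultiGraph V E}

section Flag

variable [Fintype V] [Fintype E] [DecidableEq E] {a b c : V} (hca : c ≠ a) (hcb : c ≠ b)
  (hc : ∀ e, ¬ G.Joins e c a ∧ ¬ G.Joins e c b) (hne : a ≠ b) (O : Config E)

open Classical in
/-- The `Good_a` sources of the part with flag `y`. -/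
noncomputable def rcGoodAY (G : MultiGraph V E) (a b c : V) (O : Config E) (y : Bool) : Finset (Config E) :=
  (G.rcSrcSetY a b c O y).filter fun S => G.WalkAvoiding S (G.cluster Sᶜ a) c b

open Classical in
/-- The `Good_b` sources of the part with flag `y`. -/
noncomputable def rcGoodBY (G : MultiGraph V E) (a b c : V) (O : Config E) (y : Bool) : Finset (Config E) :=
  (G.rcSrcSetY a b c O y).filter fun S => G.WalkAvoiding S (G.cluster Sᶜ b) c a

open Classical in
/-- Membership in the part with flag `y`. -/
theorem mem_rcSrcSetY {y : Bool} {S : Config E} :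
    S ∈ G.rcSrcSetY a b c O y ↔ G.IsRcSrc a b c O S ∧ decide (G.RedBridge a b c O S) = y := by
  classical
  unfold rcSrcSetY
  rw [mem_filter, mem_rcSrcSet]

/-- The valid patterns for the flag `y`: `ValidOr` for `true`, `ValidAnd` for `false`. -/
def ValidFlag {E' : Type*} (P : Problem V E') (y : Bool) (x : P.Term → Bool) : Prop :=
  P.Adm x ∧ ValidY P (y = true) x

omit [Fintype V] [Fintype E] [DecidableEq E] in
/-- The flag `true` is the validity `V_∨`. -/
theorem validFlag_true_iff {E' : Type*} (P : Problem V E') (x : P.Term → Bool) :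
    ValidFlag P true x ↔ P.ValidOr x := by
  unfold ValidFlag Problem.ValidOr
  rw [validY_true_iff]

omit [Fintype V] [Fintype E] [DecidableEq E] in
/-- The flag `false` is the validity `V_∧`. -/
theorem validFlag_false_iff {E' : Type*} (P : Problem V E') (x : P.Term → Bool) :
    ValidFlag P false x ↔ P.ValidAnd x := by
  unfold ValidFlag Problem.ValidAnd
  rw [validY_false_iff]

include hca hcb hc hne in
open Classical in
/-- A source of the part with flag `y` has a pattern valid for the flag. -/
theorem validFlag_of_mem_rcSrcSetY {y : Bool} {S : Config E} (hS : S ∈ G.rcSrcSetY a b c O y) :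
    ValidFlag (G.rcPort a b c O hca hcb hc) y (rcPattern hca hcb hc S) := by
  rw [mem_rcSrcSetY] at hS
  have h := ((rcSrc_iff_gen hca hcb hc hne).1 hS.1).1
  refine ⟨h.1, ?_⟩
  unfold ValidY at h ⊢
  rw [← redBridge_iff_flag O hS.2]
  exact h.2

include hca hcb hc hne in
open Classical in
/-- **The fibre sizes on the part with flag `y`.** -/
theorem exists_fibre_size_flag (y : Bool) : ∃ N : ℕ, ∀ x : (G.rcPort a b c O hca hcb hc).Term → Bool,
    #(rcFibreY hca hcb hc O y x) = if ValidFlag (G.rcPort a b c O hca hcb hc) y x then N else 0 := by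
  by_cases hex : ∃ x₀ : (G.rcPort a b c O hca hcb hc).Term → Bool, ValidFlag (G.rcPort a b c O hca hcb hc) y x₀
  · obtain ⟨x₀, hx₀⟩ := hex
    refine ⟨#(rcFibreY hca hcb hc O y x₀), fun x => ?_⟩
    by_cases hx : ValidFlag (G.rcPort a b c O hca hcb hc) y x
    · rw [if_pos hx]
      exact card_rcFibreY_eq hca hcb hc hne O hx hx₀
    · rw [if_neg hx, rcFibreY_eq_empty hca hcb hc hne O hx, card_empty]
  · refine ⟨0, fun x => ?_⟩
    have hx : ¬ ValidFlag (G.rcPort a b c O hca hcb hc) y x := fun h => hex ⟨x, h⟩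
    rw [if_neg hx, rcFibreY_eq_empty hca hcb hc hne O hx, card_empty]

include hne in
open Classical in
/-- The fibre of `x` among the `Good_a` sources of the part is the fibre of `x` when `Good₁ x`, empty otherwise. -/
theorem card_rcGoodAY_fibre (y : Bool) (x : (G.rcPort a b c O hca hcb hc).Term → Bool) :
    #((G.rcGoodAY a b c O y).filter fun S => rcPattern hca hcb hc S = x) =
      if (G.rcPort a b c O hca hcb hc).Good₁ x then #(rcFibreY hca hcb hc O y x) else 0 := by
  split_ifs with hg
  · apply congrArg Finset.card
    ext S
    unfold rcGoodAY
    rw [mem_filter, mem_filter, mem_rcSrcSetY, mem_rcFibreY]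
    constructor
    · rintro ⟨⟨⟨hS, hy⟩, _⟩, hx⟩
      exact ⟨hS, hy, hx⟩
    · rintro ⟨hS, hy, hx⟩
      refine ⟨⟨⟨hS, hy⟩, (goodA_iff_of_rcSrc hca hcb hc hne O hS).2 ?_⟩, hx⟩
      rw [hx]
      exact hg
  · rw [card_eq_zero, Finset.eq_empty_iff_forall_notMem]
    intro S hS
    unfold rcGoodAY at hS
    rw [mem_filter, mem_filter, mem_rcSrcSetY] at hS
    obtain ⟨⟨⟨hS, _⟩, hgA⟩, hx⟩ := hS
    apply hg
    rw [← hx]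
    exact (goodA_iff_of_rcSrc hca hcb hc hne O hS).1 hgA

include hne in
open Classical in
/-- The fibre of `x` among the `Good_b` sources of the part is the fibre of `x` when `Good₂ x`, empty otherwise. -/
theorem card_rcGoodBY_fibre (y : Bool) (x : (G.rcPort a b c O hca hcb hc).Term → Bool) :
    #((G.rcGoodBY a b c O y).filter fun S => rcPattern hca hcb hc S = x) =
      if (G.rcPort a b c O hca hcb hc).Good₂ x then #(rcFibreY hca hcb hc O y x) else 0 := by
  split_ifs with hg
  · apply congrArg Finset.card
    ext S
    unfold rcGoodBY
    rw [mem_filter, mem_filter, mem_rcSrcSetY, mem_rcFibreY]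
    constructor
    · rintro ⟨⟨⟨hS, hy⟩, _⟩, hx⟩
      exact ⟨hS, hy, hx⟩
    · rintro ⟨hS, hy, hx⟩
      refine ⟨⟨⟨hS, hy⟩, (goodB_iff_of_rcSrc hca hcb hc hne O hS).2 ?_⟩, hx⟩
      rw [hx]
      exact hg
  · rw [card_eq_zero, Finset.eq_empty_iff_forall_notMem]
    intro S hS
    unfold rcGoodBY at hS
    rw [mem_filter, mem_filter, mem_rcSrcSetY] at hS
    obtain ⟨⟨⟨hS, _⟩, hgB⟩, hx⟩ := hS
    apply hg
    rw [← hx]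
    exact (goodB_iff_of_rcSrc hca hcb hc hne O hS).1 hgB

open Classical in
/-- The fibre of `x` among the sources of the part is `rcFibreY y x`. -/
theorem card_rcSrcSetY_fibre (y : Bool) (x : (G.rcPort a b c O hca hcb hc).Term → Bool) :
    #((G.rcSrcSetY a b c O y).filter fun S => rcPattern hca hcb hc S = x) = #(rcFibreY hca hcb hc O y x) := by
  apply congrArg Finset.card
  ext S
  rw [mem_filter, mem_rcSrcSetY, mem_rcFibreY]
  exact and_assoc

include hca hcb hc hne in
open Classical in
/-- **The three counts of the part with flag `y` are `N_y` times the counts of the port problem** for the validity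
of the flag. -/
theorem exists_counts_eq_mul_flag (y : Bool) : ∃ N : ℕ,
    #(G.rcSrcSetY a b c O y) = N * #(univ.filter fun x => ValidFlag (G.rcPort a b c O hca hcb hc) y x) ∧
    #(G.rcGoodAY a b c O y) = N * #(univ.filter fun x =>
      ValidFlag (G.rcPort a b c O hca hcb hc) y x ∧ (G.rcPort a b c O hca hcb hc).Good₁ x) ∧
    #(G.rcGoodBY a b c O y) = N * #(univ.filter fun x =>
      ValidFlag (G.rcPort a b c O hca hcb hc) y x ∧ (G.rcPort a b c O hca hcb hc).Good₂ x) := by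
  obtain ⟨N, hN⟩ := exists_fibre_size_flag hca hcb hc hne O y
  refine ⟨N, ?_, ?_, ?_⟩
  · rw [card_eq_sum_card_fiberwise (f := rcPattern hca hcb hc) (t := univ) fun _ _ => mem_univ _,
      Finset.sum_congr rfl fun x _ => (card_rcSrcSetY_fibre hca hcb hc O y x).trans (hN x), ← Finset.sum_filter,
      Finset.sum_const, smul_eq_mul, mul_comm]
  · rw [card_eq_sum_card_fiberwise (f := rcPattern hca hcb hc) (t := univ) fun _ _ => mem_univ _,
      Finset.sum_congr rfl fun x _ => (card_rcGoodAY_fibre hca hcb hc hne O y x).trans (by rw [hN x]),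
      ← Finset.sum_filter, ← Finset.sum_filter, Finset.sum_const, smul_eq_mul, mul_comm]
    congr 2
    ext x
    rw [mem_filter, mem_filter, mem_filter]
    constructor
    · rintro ⟨⟨_, hg⟩, hv⟩
      exact ⟨mem_univ _, hv, hg⟩
    · rintro ⟨_, hv, hg⟩
      exact ⟨⟨mem_univ _, hg⟩, hv⟩
  · rw [card_eq_sum_card_fiberwise (f := rcPattern hca hcb hc) (t := univ) fun _ _ => mem_univ _,
      Finset.sum_congr rfl fun x _ => (card_rcGoodBY_fibre hca hcb hc hne O y x).trans (by rw [hN x]),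
      ← Finset.sum_filter, ← Finset.sum_filter, Finset.sum_const, smul_eq_mul, mul_comm]
    congr 2
    ext x
    rw [mem_filter, mem_filter, mem_filter]
    constructor
    · rintro ⟨⟨_, hg⟩, hv⟩
      exact ⟨mem_univ _, hv, hg⟩
    · rintro ⟨_, hv, hg⟩
      exact ⟨⟨mem_univ _, hg⟩, hv⟩

include hca hcb hc hne in
open Classical in
/-- **(CS) on the part with a bridge** (flag `true`, validity `V_∨`). -/
theorem rc_cs_flag_true : CS #(G.rcSrcSetY a b c O true) #(G.rcGoodAY a b c O true) #(G.rcGoodBY a b c O true) := by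
  obtain ⟨N, h1, h2, h3⟩ := exists_counts_eq_mul_flag hca hcb hc hne O true
  rw [h1, h2, h3]
  have e1 : (univ.filter fun x => ValidFlag (G.rcPort a b c O hca hcb hc) true x) =
      (G.rcPort a b c O hca hcb hc).validSet := by
    ext x
    rw [mem_filter, Problem.mem_validSet, validFlag_true_iff]
    exact and_iff_right (mem_univ _)
  have e2 : (univ.filter fun x => ValidFlag (G.rcPort a b c O hca hcb hc) true x ∧
      (G.rcPort a b c O hca hcb hc).Good₁ x) = (G.rcPort a b c O hca hcb hc).good₁Set := by
    ext x
    rw [mem_filter, Problem.mem_good₁Set, validFlag_true_iff]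
    exact and_iff_right (mem_univ _)
  have e3 : (univ.filter fun x => ValidFlag (G.rcPort a b c O hca hcb hc) true x ∧
      (G.rcPort a b c O hca hcb hc).Good₂ x) = (G.rcPort a b c O hca hcb hc).good₂Set := by
    ext x
    rw [mem_filter, Problem.mem_good₂Set, validFlag_true_iff]
    exact and_iff_right (mem_univ _)
  rw [e1, e2, e3]
  exact cs_mul N (Problem.csOr_of_zonesReached _ (rcPort_zonesReached hca hcb hc))

include hca hcb hc hne in
open Classical in
/-- **(CS) on the part without a bridge** (flag `false`, validity `V_∧`). -/
theorem rc_cs_flag_false :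
    CS #(G.rcSrcSetY a b c O false) #(G.rcGoodAY a b c O false) #(G.rcGoodBY a b c O false) := by
  obtain ⟨N, h1, h2, h3⟩ := exists_counts_eq_mul_flag hca hcb hc hne O false
  rw [h1, h2, h3]
  have e1 : (univ.filter fun x => ValidFlag (G.rcPort a b c O hca hcb hc) false x) =
      (G.rcPort a b c O hca hcb hc).validAndSet := by
    ext x
    rw [mem_filter, Problem.mem_validAndSet, validFlag_false_iff]
    exact and_iff_right (mem_univ _)
  have e2 : (univ.filter fun x => ValidFlag (G.rcPort a b c O hca hcb hc) false x ∧
      (G.rcPort a b c O hca hcb hc).Good₁ x) = (G.rcPort a b c O hca hcb hc).good₁AndSet := by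
    ext x
    rw [mem_filter, Problem.mem_good₁AndSet, validFlag_false_iff]
    exact and_iff_right (mem_univ _)
  have e3 : (univ.filter fun x => ValidFlag (G.rcPort a b c O hca hcb hc) false x ∧
      (G.rcPort a b c O hca hcb hc).Good₂ x) = (G.rcPort a b c O hca hcb hc).good₂AndSet := by
    ext x
    rw [mem_filter, Problem.mem_good₂AndSet, validFlag_false_iff]
    exact and_iff_right (mem_univ _)
  rw [e1, e2, e3]
  exact cs_mul N (Problem.csAnd_of_zonesReached _ (rcPort_zonesReached hca hcb hc))

open Classical in
/-- The sources split into the two parts. -/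
theorem card_rcSrcSet_eq_parts :
    #(G.rcSrcSet a b c O) = #(G.rcSrcSetY a b c O true) + #(G.rcSrcSetY a b c O false) := by
  unfold rcSrcSetY
  rw [← Finset.card_filter_add_card_filter_not (s := G.rcSrcSet a b c O) fun S => decide (G.RedBridge a b c O S) = true]
  congr 2
  apply Finset.filter_congr
  intro S _
  cases decide (G.RedBridge a b c O S) <;> simp

open Classical in
/-- The `Good_a` sources split into the two parts. -/
theorem card_rcGoodA_eq_parts :
    #(G.rcGoodA a b c O) = #(G.rcGoodAY a b c O true) + #(G.rcGoodAY a b c O false) := by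
  unfold rcGoodAY rcSrcSetY
  rw [Finset.filter_filter, Finset.filter_filter, ← Finset.card_filter_add_card_filter_not (s := G.rcGoodA a b c O)
    fun S => decide (G.RedBridge a b c O S) = true]
  unfold rcGoodA
  rw [Finset.filter_filter, Finset.filter_filter]
  congr 2
  · apply Finset.filter_congr
    intro S _
    exact and_comm
  · apply Finset.filter_congr
    intro S _
    cases decide (G.RedBridge a b c O S) <;> simp [and_comm]

open Classical in
/-- The `Good_b` sources split into the two parts. -/
theorem card_rcGoodB_eq_parts :
    #(G.rcGoodB a b c O) = #(G.rcGoodBY a b c O true) + #(G.rcGoodBY a b c O false) := by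
  unfold rcGoodBY rcSrcSetY
  rw [Finset.filter_filter, Finset.filter_filter, ← Finset.card_filter_add_card_filter_not (s := G.rcGoodB a b c O)
    fun S => decide (G.RedBridge a b c O S) = true]
  unfold rcGoodB
  rw [Finset.filter_filter, Finset.filter_filter]
  congr 2
  · apply Finset.filter_congr
    intro S _
    exact and_comm
  · apply Finset.filter_congr
    intro S _
    cases decide (G.RedBridge a b c O S) <;> simp [and_comm]

include hca hcb hc hne in
open Classical in
/-- **THEOREM R-CS ON SKELETONS, «12 ∈ E or not», per colouring**: on every skeleton with the probe not adjacent to a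
terminal, `c ≠ a, b`, `a ≠ b`, for every bare colouring `O`, `(#𝒮_rc(O) − #Good_a − #Good_b)₊² ≤ #Good_a · #Good_b`. -/
theorem rc_cs_of_bare_gen : CS #(G.rcSrcSet a b c O) #(G.rcGoodA a b c O) #(G.rcGoodB a b c O) := by
  rw [card_rcSrcSet_eq_parts, card_rcGoodA_eq_parts, card_rcGoodB_eq_parts]
  have h1 := rc_cs_flag_true hca hcb hc hne O
  have h0 := rc_cs_flag_false hca hcb hc hne O
  unfold CS at h1 h0 ⊢
  calc (#(G.rcSrcSetY a b c O true) + #(G.rcSrcSetY a b c O false) -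
      (#(G.rcGoodAY a b c O true) + #(G.rcGoodAY a b c O false)) -
      (#(G.rcGoodBY a b c O true) + #(G.rcGoodBY a b c O false))) ^ 2
      ≤ ((#(G.rcSrcSetY a b c O true) - #(G.rcGoodAY a b c O true) - #(G.rcGoodBY a b c O true)) +
        (#(G.rcSrcSetY a b c O false) - #(G.rcGoodAY a b c O false) - #(G.rcGoodBY a b c O false))) ^ 2 :=
      Nat.pow_le_pow_left (by omega) 2
    _ ≤ _ := cs_add h1 h0

end Flag

section All

variable [Fintype V] [Fintype E] [DecidableEq E] (a b c : V)

open Classical in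
/-- **THEOREM R-CS ON SKELETONS, «12 ∈ E or not», all colourings**: `c ≠ a, b`, `a ≠ b`, no edge between the terminals
assumed. -/
theorem rc_cs_gen (hca : c ≠ a) (hcb : c ≠ b) (hne : a ≠ b) :
    CS #(G.rcSrcAll a b c) #(G.rcGoodAAll a b c) #(G.rcGoodBAll a b c) := by
  by_cases hadj : ∃ e, G.Joins e c a ∨ G.Joins e c b
  · exact rc_cs_all_of_adj a b c hadj
  have hc : ∀ e, ¬ G.Joins e c a ∧ ¬ G.Joins e c b :=
    fun e => ⟨fun h => hadj ⟨e, Or.inl h⟩, fun h => hadj ⟨e, Or.inr h⟩⟩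
  rw [card_eq_sum_card_fiberwise (s := G.rcSrcAll a b c) (f := G.bareOf a b) (t := univ) fun _ _ => mem_univ _,
    card_eq_sum_card_fiberwise (s := G.rcGoodAAll a b c) (f := G.bareOf a b) (t := univ) fun _ _ => mem_univ _,
    card_eq_sum_card_fiberwise (s := G.rcGoodBAll a b c) (f := G.bareOf a b) (t := univ) fun _ _ => mem_univ _]
  apply cs_of_fibres
  intro O _
  by_cases h : ((G.rcSrcAll a b c).filter fun S => G.bareOf a b S = O).Nonempty
  · obtain ⟨S₀, hS₀⟩ := h
    rw [mem_filter] at hS₀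
    rw [← hS₀.2, filter_bareOf_eq_rc a b c S₀, filter_bareOf_eq_rcGoodA a b c S₀, filter_bareOf_eq_rcGoodB a b c S₀]
    exact rc_cs_of_bare_gen hca hcb hc hne _
  · rw [Finset.not_nonempty_iff_eq_empty] at h
    rw [h, card_empty]
    exact cs_of_le (Nat.zero_le _)

open Classical in
/-- **THEOREM R-CS ON EVERY SKELETON, NO HYPOTHESIS** (mine-3's CONJECTURE (CS), C-041.md §16, on the sources all of
whose attached zones are internally red-connected): `(#rcSrcAll − #Good_a − #Good_b)₊² ≤ #Good_a · #Good_b` — the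
(CS) form of `rc_theoremR`. -/
theorem rc_theoremR_cs : CS #(G.rcSrcAll a b c) #(G.rcGoodAAll a b c) #(G.rcGoodBAll a b c) := by
  by_cases hne : c ≠ a ∧ c ≠ b ∧ a ≠ b
  · exact rc_cs_gen a b c hne.1 hne.2.1 hne.2.2
  · -- no source at all
    apply cs_of_le
    have : G.rcSrcAll a b c = ∅ := by
      rw [Finset.eq_empty_iff_forall_notMem]
      intro S hS
      rw [mem_rcSrcAll] at hS
      exact hne (ne_of_rcSrc a b c hS)
    rw [this, card_empty]
    exact Nat.zero_le _

end All

end MultiGraph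

end PercRepro
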